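import Mathlib
import Summits.ValiantsHypothesis.ValiantsHypothesis.Theses.ValuativeGCT
import Summits.ValiantsHypothesis.ValiantsHypothesis.Theorems.CutBites.Negative.NonVacuity
import Summits.ValiantsHypothesis.ValiantsHypothesis.Theorems.CutBites.Negative.NoCutForColumnCompression
import Summits.ValiantsHypothesis.ValiantsHypothesis.Theorems.CutBites.Negative.LeftSLInvariantsDetPow

/-!
# `CutBites` — negative lemma: ONE-ROW WEIGHTS ARE NEVER CUT; `dim T 0 = 1` AT `λ = (mδ)`

Crux `stmt-ValiantsHypothesis-12626` (`Theses.ValuativeGCT.CutBites`, route ValuativeGCT).  Standing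
disprover (cdisprove gen 3), `Cruxes/CutBites/Disproof.lean` §I, over the crux's literal `let`-blocks at the
one-row partition `λ = (mδ)` (`Nat.Partition.indiscrete`, `m = n + 1`).  Tightness of `NonVacuity`
(`det_m(last row)^δ ∈ T 0 ∩ T δ`): the converse inclusion.

* `vars_subset_lastRow_of_oneRow_semiInvariant` — a `B`-semi-invariant of weight `((mδ))*` (the crux's
  Borel clause verbatim) is a polynomial in the LAST ROW only (torus element `diag(2, …, 2, 1)`).
* `cutBites_trunc_zero_oneRow_eq_span` — **`T 0 = ℂ · det_m(last row)^δ`** for every `m ≥ 1`, `δ ≥ 1`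
  (descent to one row + `LeftSLInvariantsDetPow`: left-`SL_m`-invariant forms of degree `mδ` are
  `c · det^δ`); `cutBites_finrank_trunc_zero_oneRow` — hence `finrank (T 0) = 1`, the first exact
  dimension of a truncation space (the symmetric Kronecker count at the one-row shape).
* `cutBites_trunc_oneRow_eq_of_odd` — for ODD `m`: `T t = T 0` for every `t ≤ δ` at `λ = (mδ)`;
  `cutBites_not_lt_oneRow_of_odd`, `cutBites_no_cut_at_oneRow_weight` — the strengthening of the crux
  "for every odd `m ≥ 3` some ONE-ROW weight `(mδ)` is cut" is FALSE (witness `m = 3`; every odd `m`,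
  every `δ`).  A cut — and a fortiori a flip on the Edmonds-gap side — lives on shapes with `≥ 2` rows.
[folklore]
-/

namespace Summit.ValiantsHypothesis.ValiantsHypothesis.Theorems.CutBites.Negative

open Literature.NumberTheory.DiophantineGeometry Literature.Computability.AlgebraicComplexity
open MvPolynomial
open scoped BigOperators Matrix

noncomputable section

/-- **Torus bookkeeping.**  A `B`-semi-invariant of the one-row weight `((mδ))*` (`δ ≥ 1`) for the crux's
Borel action `G ↦ G(g⁻¹A)` involves only the variables of the LAST row `matIdxEquiv m (Fin.rev 0)`:
the diagonal element `diag(2, …, 2, 1)` has weight character `1` and rescales every other row. [folklore] -/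
theorem vars_subset_lastRow_of_oneRow_semiInvariant {n δ : ℕ} (hδ : 0 < δ)
    {G : MvPolynomial (MatIdx (n + 1) × MatIdx (n + 1)) ℂ}
    (hG : ∀ g : Matrix.GeneralLinearGroup (MatIdx (n + 1)) ℂ, IsUpperTriangular g →
      MvPolynomial.aeval (R := ℂ) (fun p : MatIdx (n + 1) × MatIdx (n + 1) =>
        ∑ l : MatIdx (n + 1), ((g⁻¹ : Matrix.GeneralLinearGroup (MatIdx (n + 1)) ℂ) :
          Matrix (MatIdx (n + 1)) (MatIdx (n + 1)) ℂ) p.1 l • MvPolynomial.X (l, p.2)) G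
        = weightChar (Weight.dualOfPartition ((n + 1) * (n + 1))
            (Nat.Partition.indiscrete ((n + 1) * δ))).toMatIdx g • G) :
    (↑G.vars : Set (MatIdx (n + 1) × MatIdx (n + 1)))
      ⊆ Set.range (fun i : MatIdx (n + 1) => (matIdxEquiv (n + 1) (Fin.rev 0), i)) := by
  set jT : MatIdx (n + 1) := matIdxEquiv (n + 1) (Fin.rev 0) with hjT
  set d : MatIdx (n + 1) → ℂ := fun j => if j = jT then 1 else 2 with hd
  have hd1 : ∀ j, j = jT → d j = 1 := fun j h => if_pos h
  have hd2 : ∀ j, ¬ j = jT → d j = 2 := fun j h => if_neg h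
  have hd0 : ∀ j, d j ≠ 0 := by
    intro j
    by_cases h : j = jT
    · rw [hd1 j h]; exact one_ne_zero
    · rw [hd2 j h]; exact two_ne_zero
  have hunit : IsUnit (Matrix.diagonal d).det := by
    rw [Matrix.det_diagonal]
    exact isUnit_iff_ne_zero.mpr (Finset.prod_ne_zero_iff.mpr fun j _ => hd0 j)
  set g : Matrix.GeneralLinearGroup (MatIdx (n + 1)) ℂ := Matrix.nonsingInvUnit (Matrix.diagonal d) hunit
    with hgdef
  have hcoe : (g : Matrix (MatIdx (n + 1)) (MatIdx (n + 1)) ℂ) = Matrix.diagonal d := rfl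
  have hinvcoe : ((g⁻¹ : Matrix.GeneralLinearGroup (MatIdx (n + 1)) ℂ) : Matrix (MatIdx (n + 1)) (MatIdx (n + 1)) ℂ)
      = Matrix.diagonal fun j => (d j)⁻¹ := by
    rw [Matrix.coe_units_inv, hcoe]
    refine Matrix.inv_eq_left_inv ?_
    rw [Matrix.diagonal_mul_diagonal, ← Matrix.diagonal_one]
    congr 1
    funext j
    exact inv_mul_cancel₀ (hd0 j)
  have hup : IsUpperTriangular g := by
    show (g : Matrix (MatIdx (n + 1)) (MatIdx (n + 1)) ℂ).BlockTriangular id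
    rw [hcoe]
    exact Matrix.blockTriangular_diagonal _
  have hchar : weightChar (Weight.dualOfPartition ((n + 1) * (n + 1))
      (Nat.Partition.indiscrete ((n + 1) * δ))).toMatIdx g = 1 := by
    rw [weightChar_oneRow hδ, hcoe, Matrix.diagonal_apply_eq, hd1 jT rfl, one_zpow]
  have hact : (MvPolynomial.aeval (R := ℂ) fun p : MatIdx (n + 1) × MatIdx (n + 1) =>
        ∑ l : MatIdx (n + 1), ((g⁻¹ : Matrix.GeneralLinearGroup (MatIdx (n + 1)) ℂ) :
          Matrix (MatIdx (n + 1)) (MatIdx (n + 1)) ℂ) p.1 l •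
            (MvPolynomial.X (l, p.2) : MvPolynomial (MatIdx (n + 1) × MatIdx (n + 1)) ℂ))
      = MvPolynomial.aeval (R := ℂ) fun p : MatIdx (n + 1) × MatIdx (n + 1) =>
          (d p.1)⁻¹ • (X p : MvPolynomial (MatIdx (n + 1) × MatIdx (n + 1)) ℂ) := by
    refine MvPolynomial.algHom_ext fun p => ?_
    rw [aeval_X, aeval_X, hinvcoe]
    simp only [Matrix.diagonal_apply, ite_smul, zero_smul, Finset.sum_ite_eq, Finset.mem_univ, if_true]
  have hinv : MvPolynomial.aeval (R := ℂ) (fun p : MatIdx (n + 1) × MatIdx (n + 1) =>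
      (d p.1)⁻¹ • (X p : MvPolynomial (MatIdx (n + 1) × MatIdx (n + 1)) ℂ)) G = G := by
    have h := hG g hup
    rw [hact, hchar, one_smul] at h
    exact h
  intro p hp
  rw [Finset.mem_coe, mem_vars_iff_mem_support] at hp
  obtain ⟨α, hα, hpα⟩ := hp
  have hw := prod_eq_one_of_smul_X_invariant hinv hα
  rw [← Finset.prod_filter_mul_prod_filter_not α.support (fun q => q.1 = jT),
    Finset.prod_eq_one (fun q hq => by rw [hd1 q.1 (Finset.mem_filter.mp hq).2, inv_one, one_pow]),
    one_mul] at hw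
  have hw' : ∏ q ∈ α.support with ¬ q.1 = jT, ((2 : ℂ)⁻¹) ^ α q = 1 := by
    rw [← hw]
    exact Finset.prod_congr rfl fun q hq => by rw [hd2 q.1 (Finset.mem_filter.mp hq).2]
  rw [Finset.prod_pow_eq_pow_sum] at hw'
  have he : (∑ q ∈ α.support with ¬ q.1 = jT, α q) = 0 := by
    rw [inv_pow, inv_eq_one] at hw'
    have h2 : (2 : ℕ) ^ (∑ q ∈ α.support with ¬ q.1 = jT, α q) = 1 := by exact_mod_cast hw'
    exact (Nat.pow_eq_one.mp h2).resolve_left (by norm_num)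
  by_cases hp1 : p.1 = jT
  · exact ⟨p.2, by rw [← hp1]⟩
  · exfalso
    have hle : α p ≤ ∑ q ∈ α.support with ¬ q.1 = jT, α q :=
      Finset.single_le_sum (f := fun q => α q) (fun _ _ => Nat.zero_le _) (Finset.mem_filter.mpr ⟨hpα, hp1⟩)
    have hpos : 0 < α p := Nat.pos_of_ne_zero (Finsupp.mem_support_iff.mp hpα)
    omega

/-- **`T 0 ≤ ℂ · det_m(last row)^δ`** at the one-row weight (`m = n + 1 ≥ 1`, `δ ≥ 1`): torus
bookkeeping, descent of `H`-invariance to the row polynomial, left multiplications in the stabiliser,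
and the classification of left-`SL_m`-invariant forms of degree `mδ`. [folklore] -/
theorem cutBites_trunc_zero_oneRow_le_span (n δ : ℕ) (hδ : 0 < δ) :
    (let U : Submodule ℂ (MatIdx (n + 1) → ℂ) :=
        Submodule.span ℂ {u : MatIdx (n + 1) → ℂ | ∀ a b : Fin (n + 1), u (toLex (a, b)) = -u (toLex (b, a))};
      let χ : Weight (MatIdx (n + 1)) := (Weight.dualOfPartition ((n + 1) * (n + 1)) (Nat.Partition.indiscrete ((n + 1) * δ))).toMatIdx;
      let T : ℕ → Submodule ℂ (MvPolynomial (MatIdx (n + 1) × MatIdx (n + 1)) ℂ) := fun t =>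
        MvPolynomial.homogeneousSubmodule (MatIdx (n + 1) × MatIdx (n + 1)) ℂ ((n + 1) * δ)
        ⊓ ((MvPolynomial.vanishingIdeal ℂ {p : MatIdx (n + 1) × MatIdx (n + 1) → ℂ |
              ∀ j : MatIdx (n + 1), (fun i => p (j, i)) ∈ U}) ^ (t)).restrictScalars ℂ
        ⊓ (⨅ (M : Matrix (MatIdx (n + 1)) (MatIdx (n + 1)) ℂ)
            (_ : linSubst (MatIdx (n + 1)) ℂ M (detFormLex ℂ (n + 1)) = detFormLex ℂ (n + 1)),
            LinearMap.ker ((MvPolynomial.aeval (R := ℂ) fun p : MatIdx (n + 1) × MatIdx (n + 1) =>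
              ∑ l : MatIdx (n + 1), M l p.2 • MvPolynomial.X (p.1, l)).toLinearMap
              - LinearMap.id (R := ℂ) (M := MvPolynomial (MatIdx (n + 1) × MatIdx (n + 1)) ℂ)))
        ⊓ (⨅ (g : Matrix.GeneralLinearGroup (MatIdx (n + 1)) ℂ) (_ : IsUpperTriangular g),
            LinearMap.ker ((MvPolynomial.aeval (R := ℂ) fun p : MatIdx (n + 1) × MatIdx (n + 1) =>
              ∑ l : MatIdx (n + 1), ((g⁻¹ : Matrix.GeneralLinearGroup (MatIdx (n + 1)) ℂ) :
                Matrix (MatIdx (n + 1)) (MatIdx (n + 1)) ℂ) p.1 l • MvPolynomial.X (l, p.2)).toLinearMap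
              - weightChar χ g • LinearMap.id (R := ℂ) (M := MvPolynomial (MatIdx (n + 1) × MatIdx (n + 1)) ℂ)));
      T 0 ≤ Submodule.span ℂ {(rename (fun i : MatIdx (n + 1) => ((matIdxEquiv (n + 1) (Fin.rev 0)), i)) (detFormLex ℂ (n + 1))) ^ δ}) := by
  intro U χ T G hG
  have hGh := (Submodule.mem_inf.mp (Submodule.mem_inf.mp (Submodule.mem_inf.mp hG).1).1).1
  have hGs := (Submodule.mem_inf.mp (Submodule.mem_inf.mp hG).1).2
  have hGw := (Submodule.mem_inf.mp hG).2
  have hGw' : ∀ g : Matrix.GeneralLinearGroup (MatIdx (n + 1)) ℂ, IsUpperTriangular g →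
      MvPolynomial.aeval (R := ℂ) (fun p : MatIdx (n + 1) × MatIdx (n + 1) =>
        ∑ l : MatIdx (n + 1), ((g⁻¹ : Matrix.GeneralLinearGroup (MatIdx (n + 1)) ℂ) :
          Matrix (MatIdx (n + 1)) (MatIdx (n + 1)) ℂ) p.1 l • MvPolynomial.X (l, p.2)) G
        = weightChar χ g • G := by
    intro g hg
    have h := (Submodule.mem_iInf _).mp ((Submodule.mem_iInf _).mp hGw g) hg
    rw [LinearMap.mem_ker, LinearMap.sub_apply, sub_eq_zero] at h
    simpa only [AlgHom.toLinearMap_apply, LinearMap.smul_apply, LinearMap.id_coe, id_eq] using h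
  obtain ⟨q, rfl⟩ := exists_rename_eq_of_vars_subset_range G _ (Prod.mk_right_injective _)
    (vars_subset_lastRow_of_oneRow_semiInvariant hδ hGw')
  have hqh : q.IsHomogeneous ((n + 1) * δ) :=
    (IsHomogeneous.rename_isHomogeneous_iff (Prod.mk_right_injective _)).mp
      ((mem_homogeneousSubmodule _ _).mp hGh)
  have hqinv : ∀ P : Matrix (Fin (n + 1)) (Fin (n + 1)) ℂ, P.det = 1 →
      linSubst (MatIdx (n + 1)) ℂ (Matrix.of fun l i : MatIdx (n + 1) =>
        if (ofLex l).2 = (ofLex i).2 then P (ofLex i).1 (ofLex l).1 else 0) q = q := by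
    intro P hP
    have h := (Submodule.mem_iInf _).mp ((Submodule.mem_iInf _).mp hGs (Matrix.of fun l i : MatIdx (n + 1) =>
      if (ofLex l).2 = (ofLex i).2 then P (ofLex i).1 (ofLex l).1 else 0)) (linSubst_leftMul_detFormLex P hP)
    rw [LinearMap.mem_ker, LinearMap.sub_apply, sub_eq_zero] at h
    exact linSubst_eq_of_rename_rowAct_invariant h
  obtain ⟨c, hc⟩ := eq_C_mul_detFormLex_pow_of_leftSL_invariant (Nat.succ_pos n) hqh hqinv
  rw [Submodule.mem_span_singleton]
  exact ⟨c, by rw [hc, map_mul, rename_C, map_pow, smul_eq_C_mul]⟩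

/-- **`T 0 = ℂ · det_m(last row)^δ`** at the one-row weight, for every `m ≥ 1`, `δ ≥ 1`. [folklore] -/
theorem cutBites_trunc_zero_oneRow_eq_span (n δ : ℕ) (hδ : 0 < δ) :
    (let U : Submodule ℂ (MatIdx (n + 1) → ℂ) :=
        Submodule.span ℂ {u : MatIdx (n + 1) → ℂ | ∀ a b : Fin (n + 1), u (toLex (a, b)) = -u (toLex (b, a))};
      let χ : Weight (MatIdx (n + 1)) := (Weight.dualOfPartition ((n + 1) * (n + 1)) (Nat.Partition.indiscrete ((n + 1) * δ))).toMatIdx;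
      let T : ℕ → Submodule ℂ (MvPolynomial (MatIdx (n + 1) × MatIdx (n + 1)) ℂ) := fun t =>
        MvPolynomial.homogeneousSubmodule (MatIdx (n + 1) × MatIdx (n + 1)) ℂ ((n + 1) * δ)
        ⊓ ((MvPolynomial.vanishingIdeal ℂ {p : MatIdx (n + 1) × MatIdx (n + 1) → ℂ |
              ∀ j : MatIdx (n + 1), (fun i => p (j, i)) ∈ U}) ^ (t)).restrictScalars ℂ
        ⊓ (⨅ (M : Matrix (MatIdx (n + 1)) (MatIdx (n + 1)) ℂ)
            (_ : linSubst (MatIdx (n + 1)) ℂ M (detFormLex ℂ (n + 1)) = detFormLex ℂ (n + 1)),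
            LinearMap.ker ((MvPolynomial.aeval (R := ℂ) fun p : MatIdx (n + 1) × MatIdx (n + 1) =>
              ∑ l : MatIdx (n + 1), M l p.2 • MvPolynomial.X (p.1, l)).toLinearMap
              - LinearMap.id (R := ℂ) (M := MvPolynomial (MatIdx (n + 1) × MatIdx (n + 1)) ℂ)))
        ⊓ (⨅ (g : Matrix.GeneralLinearGroup (MatIdx (n + 1)) ℂ) (_ : IsUpperTriangular g),
            LinearMap.ker ((MvPolynomial.aeval (R := ℂ) fun p : MatIdx (n + 1) × MatIdx (n + 1) =>
              ∑ l : MatIdx (n + 1), ((g⁻¹ : Matrix.GeneralLinearGroup (MatIdx (n + 1)) ℂ) :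
                Matrix (MatIdx (n + 1)) (MatIdx (n + 1)) ℂ) p.1 l • MvPolynomial.X (l, p.2)).toLinearMap
              - weightChar χ g • LinearMap.id (R := ℂ) (M := MvPolynomial (MatIdx (n + 1) × MatIdx (n + 1)) ℂ)));
      T 0 = Submodule.span ℂ {(rename (fun i : MatIdx (n + 1) => ((matIdxEquiv (n + 1) (Fin.rev 0)), i)) (detFormLex ℂ (n + 1))) ^ δ}) := by
  intro U χ T
  refine le_antisymm (cutBites_trunc_zero_oneRow_le_span n δ hδ) ?_
  rw [Submodule.span_singleton_le_iff_mem]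
  exact cutBites_detRowLast_pow_mem_trunc_zero n δ hδ

/-- **`finrank (T 0) = 1`** at the one-row weight (every `m ≥ 1`, `δ ≥ 1`): the untruncated symmetric
Kronecker count at the one-row shape is `1`. [folklore] -/
theorem cutBites_finrank_trunc_zero_oneRow (n δ : ℕ) (hδ : 0 < δ) :
    (let U : Submodule ℂ (MatIdx (n + 1) → ℂ) :=
        Submodule.span ℂ {u : MatIdx (n + 1) → ℂ | ∀ a b : Fin (n + 1), u (toLex (a, b)) = -u (toLex (b, a))};
      let χ : Weight (MatIdx (n + 1)) := (Weight.dualOfPartition ((n + 1) * (n + 1)) (Nat.Partition.indiscrete ((n + 1) * δ))).toMatIdx;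
      let T : ℕ → Submodule ℂ (MvPolynomial (MatIdx (n + 1) × MatIdx (n + 1)) ℂ) := fun t =>
        MvPolynomial.homogeneousSubmodule (MatIdx (n + 1) × MatIdx (n + 1)) ℂ ((n + 1) * δ)
        ⊓ ((MvPolynomial.vanishingIdeal ℂ {p : MatIdx (n + 1) × MatIdx (n + 1) → ℂ |
              ∀ j : MatIdx (n + 1), (fun i => p (j, i)) ∈ U}) ^ (t)).restrictScalars ℂ
        ⊓ (⨅ (M : Matrix (MatIdx (n + 1)) (MatIdx (n + 1)) ℂ)
            (_ : linSubst (MatIdx (n + 1)) ℂ M (detFormLex ℂ (n + 1)) = detFormLex ℂ (n + 1)),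
            LinearMap.ker ((MvPolynomial.aeval (R := ℂ) fun p : MatIdx (n + 1) × MatIdx (n + 1) =>
              ∑ l : MatIdx (n + 1), M l p.2 • MvPolynomial.X (p.1, l)).toLinearMap
              - LinearMap.id (R := ℂ) (M := MvPolynomial (MatIdx (n + 1) × MatIdx (n + 1)) ℂ)))
        ⊓ (⨅ (g : Matrix.GeneralLinearGroup (MatIdx (n + 1)) ℂ) (_ : IsUpperTriangular g),
            LinearMap.ker ((MvPolynomial.aeval (R := ℂ) fun p : MatIdx (n + 1) × MatIdx (n + 1) =>
              ∑ l : MatIdx (n + 1), ((g⁻¹ : Matrix.GeneralLinearGroup (MatIdx (n + 1)) ℂ) :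
                Matrix (MatIdx (n + 1)) (MatIdx (n + 1)) ℂ) p.1 l • MvPolynomial.X (l, p.2)).toLinearMap
              - weightChar χ g • LinearMap.id (R := ℂ) (M := MvPolynomial (MatIdx (n + 1) × MatIdx (n + 1)) ℂ)));
      Module.finrank ℂ ↥(T 0) = 1) := by
  intro U χ T
  have key : T 0 = Submodule.span ℂ {(rename (fun i : MatIdx (n + 1) => ((matIdxEquiv (n + 1) (Fin.rev 0)), i)) (detFormLex ℂ (n + 1))) ^ δ} := cutBites_trunc_zero_oneRow_eq_span n δ hδ
  rw [key]
  exact finrank_span_singleton (detRowLast_pow_ne_zero n δ)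

/-- **One-row weights are never cut (odd `m`).**  At `λ = (mδ)`, `T t = T 0` for every `t ≤ δ`.
[folklore] -/
theorem cutBites_trunc_oneRow_eq_of_odd (n δ : ℕ) (hm : Odd (n + 1)) (hδ : 0 < δ) (t : ℕ) (ht : t ≤ δ) :
    (let U : Submodule ℂ (MatIdx (n + 1) → ℂ) :=
        Submodule.span ℂ {u : MatIdx (n + 1) → ℂ | ∀ a b : Fin (n + 1), u (toLex (a, b)) = -u (toLex (b, a))};
      let χ : Weight (MatIdx (n + 1)) := (Weight.dualOfPartition ((n + 1) * (n + 1)) (Nat.Partition.indiscrete ((n + 1) * δ))).toMatIdx;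
      let T : ℕ → Submodule ℂ (MvPolynomial (MatIdx (n + 1) × MatIdx (n + 1)) ℂ) := fun t =>
        MvPolynomial.homogeneousSubmodule (MatIdx (n + 1) × MatIdx (n + 1)) ℂ ((n + 1) * δ)
        ⊓ ((MvPolynomial.vanishingIdeal ℂ {p : MatIdx (n + 1) × MatIdx (n + 1) → ℂ |
              ∀ j : MatIdx (n + 1), (fun i => p (j, i)) ∈ U}) ^ (t)).restrictScalars ℂ
        ⊓ (⨅ (M : Matrix (MatIdx (n + 1)) (MatIdx (n + 1)) ℂ)
            (_ : linSubst (MatIdx (n + 1)) ℂ M (detFormLex ℂ (n + 1)) = detFormLex ℂ (n + 1)),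
            LinearMap.ker ((MvPolynomial.aeval (R := ℂ) fun p : MatIdx (n + 1) × MatIdx (n + 1) =>
              ∑ l : MatIdx (n + 1), M l p.2 • MvPolynomial.X (p.1, l)).toLinearMap
              - LinearMap.id (R := ℂ) (M := MvPolynomial (MatIdx (n + 1) × MatIdx (n + 1)) ℂ)))
        ⊓ (⨅ (g : Matrix.GeneralLinearGroup (MatIdx (n + 1)) ℂ) (_ : IsUpperTriangular g),
            LinearMap.ker ((MvPolynomial.aeval (R := ℂ) fun p : MatIdx (n + 1) × MatIdx (n + 1) =>
              ∑ l : MatIdx (n + 1), ((g⁻¹ : Matrix.GeneralLinearGroup (MatIdx (n + 1)) ℂ) :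
                Matrix (MatIdx (n + 1)) (MatIdx (n + 1)) ℂ) p.1 l • MvPolynomial.X (l, p.2)).toLinearMap
              - weightChar χ g • LinearMap.id (R := ℂ) (M := MvPolynomial (MatIdx (n + 1) × MatIdx (n + 1)) ℂ)));
      T t = T 0) := by
  intro U χ T
  refine le_antisymm ?_ ?_
  · exact inf_le_inf_right _ (inf_le_inf_right _ (inf_le_inf_left _
      (Submodule.restrictScalars_mono ℂ (Ideal.pow_le_pow_right (Nat.zero_le t)))))
  · intro G hG
    have hG' := cutBites_trunc_zero_oneRow_le_span n δ hδ hG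
    rw [Submodule.mem_span_singleton] at hG'
    obtain ⟨c, rfl⟩ := hG'
    have hmem : (rename (fun i : MatIdx (n + 1) => ((matIdxEquiv (n + 1) (Fin.rev 0)), i)) (detFormLex ℂ (n + 1))) ^ δ ∈ T δ := cutBites_detRowLast_pow_mem_trunc_delta_of_odd n δ hm hδ
    have hle : T δ ≤ T t :=
      inf_le_inf_right _ (inf_le_inf_right _ (inf_le_inf_left _
        (Submodule.restrictScalars_mono ℂ (Ideal.pow_le_pow_right ht))))
    exact Submodule.smul_mem _ c (hle hmem)

/-- At the one-row weight no threshold `δ` is ever a witness (odd `m`; `δ = 0` is trivial). [folklore] -/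
theorem cutBites_not_lt_oneRow_of_odd (n δ : ℕ) (hm : Odd (n + 1)) :
    (let U : Submodule ℂ (MatIdx (n + 1) → ℂ) :=
        Submodule.span ℂ {u : MatIdx (n + 1) → ℂ | ∀ a b : Fin (n + 1), u (toLex (a, b)) = -u (toLex (b, a))};
      let χ : Weight (MatIdx (n + 1)) := (Weight.dualOfPartition ((n + 1) * (n + 1)) (Nat.Partition.indiscrete ((n + 1) * δ))).toMatIdx;
      let T : ℕ → Submodule ℂ (MvPolynomial (MatIdx (n + 1) × MatIdx (n + 1)) ℂ) := fun t =>
        MvPolynomial.homogeneousSubmodule (MatIdx (n + 1) × MatIdx (n + 1)) ℂ ((n + 1) * δ)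
        ⊓ ((MvPolynomial.vanishingIdeal ℂ {p : MatIdx (n + 1) × MatIdx (n + 1) → ℂ |
              ∀ j : MatIdx (n + 1), (fun i => p (j, i)) ∈ U}) ^ (t)).restrictScalars ℂ
        ⊓ (⨅ (M : Matrix (MatIdx (n + 1)) (MatIdx (n + 1)) ℂ)
            (_ : linSubst (MatIdx (n + 1)) ℂ M (detFormLex ℂ (n + 1)) = detFormLex ℂ (n + 1)),
            LinearMap.ker ((MvPolynomial.aeval (R := ℂ) fun p : MatIdx (n + 1) × MatIdx (n + 1) =>
              ∑ l : MatIdx (n + 1), M l p.2 • MvPolynomial.X (p.1, l)).toLinearMap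
              - LinearMap.id (R := ℂ) (M := MvPolynomial (MatIdx (n + 1) × MatIdx (n + 1)) ℂ)))
        ⊓ (⨅ (g : Matrix.GeneralLinearGroup (MatIdx (n + 1)) ℂ) (_ : IsUpperTriangular g),
            LinearMap.ker ((MvPolynomial.aeval (R := ℂ) fun p : MatIdx (n + 1) × MatIdx (n + 1) =>
              ∑ l : MatIdx (n + 1), ((g⁻¹ : Matrix.GeneralLinearGroup (MatIdx (n + 1)) ℂ) :
                Matrix (MatIdx (n + 1)) (MatIdx (n + 1)) ℂ) p.1 l • MvPolynomial.X (l, p.2)).toLinearMap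
              - weightChar χ g • LinearMap.id (R := ℂ) (M := MvPolynomial (MatIdx (n + 1) × MatIdx (n + 1)) ℂ)));
      ¬ (Module.finrank ℂ ↥(T δ) < Module.finrank ℂ ↥(T 0))) := by
  intro U χ T
  rcases Nat.eq_zero_or_pos δ with h0 | hδ
  · subst h0
    exact lt_irrefl _
  · have key : T δ = T 0 := cutBites_trunc_oneRow_eq_of_odd n δ hm hδ δ le_rfl
    rw [key]
    exact lt_irrefl _

/-- **Refuted strengthening (one-row weights).**  "For every odd `m ≥ 3` some one-row weight `(mδ)` is
cut" is FALSE (witness `m = 3`). [folklore] -/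
theorem cutBites_no_cut_at_oneRow_weight :
    ¬ (∀ m : ℕ, Odd m → 3 ≤ m → ∃ δ : ℕ,
      (let U : Submodule ℂ (MatIdx m → ℂ) :=
        Submodule.span ℂ {u : MatIdx m → ℂ | ∀ a b : Fin m, u (toLex (a, b)) = -u (toLex (b, a))};
      let χ : Weight (MatIdx m) := (Weight.dualOfPartition (m * m) (Nat.Partition.indiscrete (m * δ))).toMatIdx;
      let T : ℕ → Submodule ℂ (MvPolynomial (MatIdx m × MatIdx m) ℂ) := fun t =>
        MvPolynomial.homogeneousSubmodule (MatIdx m × MatIdx m) ℂ (m * δ)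
        ⊓ ((MvPolynomial.vanishingIdeal ℂ {p : MatIdx m × MatIdx m → ℂ |
              ∀ j : MatIdx m, (fun i => p (j, i)) ∈ U}) ^ (t)).restrictScalars ℂ
        ⊓ (⨅ (M : Matrix (MatIdx m) (MatIdx m) ℂ)
            (_ : linSubst (MatIdx m) ℂ M (detFormLex ℂ m) = detFormLex ℂ m),
            LinearMap.ker ((MvPolynomial.aeval (R := ℂ) fun p : MatIdx m × MatIdx m =>
              ∑ l : MatIdx m, M l p.2 • MvPolynomial.X (p.1, l)).toLinearMap
              - LinearMap.id (R := ℂ) (M := MvPolynomial (MatIdx m × MatIdx m) ℂ)))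
        ⊓ (⨅ (g : Matrix.GeneralLinearGroup (MatIdx m) ℂ) (_ : IsUpperTriangular g),
            LinearMap.ker ((MvPolynomial.aeval (R := ℂ) fun p : MatIdx m × MatIdx m =>
              ∑ l : MatIdx m, ((g⁻¹ : Matrix.GeneralLinearGroup (MatIdx m) ℂ) :
                Matrix (MatIdx m) (MatIdx m) ℂ) p.1 l • MvPolynomial.X (l, p.2)).toLinearMap
              - weightChar χ g • LinearMap.id (R := ℂ) (M := MvPolynomial (MatIdx m × MatIdx m) ℂ)));
      Module.finrank ℂ ↥(T δ) < Module.finrank ℂ ↥(T 0))) := by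
  intro h
  obtain ⟨δ, hlt⟩ := h (2 + 1) (by decide) le_rfl
  exact cutBites_not_lt_oneRow_of_odd 2 δ (by decide) hlt

end

end Summit.ValiantsHypothesis.ValiantsHypothesis.Theorems.CutBites.Negative
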